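import Literature.AlgebraicGeometry.Motives.ThickeningCechModel
import Literature.AlgebraicGeometry.Morphisms.CechH1Pullback
import HarnessLib

/-!
# Theorem of the cube, Step (I): model `1`-cocycles as Čech classes on `P ×_K Spec R`

Companion to `Motives/CubeStepILift` (Görtz–Wedhorn II, Lemma 24.72, proof, Step (I), p. 548).
There the obstruction to lifting a trivialisation of `𝒪(D)` along a small extension is a family
`ε_ab ∈ C_ab ⊗_Λ k` (`C_S = Γ(W_S, 𝒪_{P × T})` the rings of a tower cover `𝒲`, `Λ = Γ(B, 𝒪_T)`)
satisfying the Čech cocycle identity in `C_abd ⊗_Λ k`. Through the model isomorphisms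
`C_S ⊗_Λ R ≅ Γ(ι_R⁻¹W_S, 𝒪_{P × Spec R})` of `Motives/ThickeningModel` (`OpenOver.modelHom`,
`modelEquiv`, natural under restriction `res_modelHom` and under slices `sliceMap_modelHom`)
such a family is a Čech `1`-cocycle of the structure sheaf of `P ×_K Spec R` on the covering
`(ι_R⁻¹W_a)_a` in the sense of `Morphisms/CechH1` — for `R = κ(x)` a cocycle of `𝒪_{X_s}` on the
fibre, "`∂(sᵢ) ∈ H¹(X_s, 𝓔_{|X_s})`" of loc. cit. This file provides the dictionary:

* `TowerCover.thickFamily 𝒲 hB R` — the covering `a ↦ ι_R⁻¹W_a` of `P ×_K Spec R` by affine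
  opens (`isAffineOpen_thickFamily`; it covers everything as soon as `Spec R → T` has image
  `{x}`, `iSup_thickFamily`);
* `TowerCover.cechOfModel` — the Čech `1`-cochain `(a, b) ↦ model(y_ab) ∈ Γ(ι_R⁻¹W_a ∩ ι_R⁻¹W_b)`
  of a model family `y_ab ∈ C_ab ⊗ R`; a cocycle when `y` satisfies the cocycle identity
  (`cechOfModel_mem_cechZ1`);
* `TowerCover.exists_coboundary_of_cechH1_eq_zero` — **if its class in `Ȟ¹` vanishes, `y` is a
  coboundary in the model**: `y_ab = η_b| − η_a|` with `η_a ∈ C_a ⊗ R`;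
* `TowerCover.cechComapH1_slice_eq_zero` — **slices**: for `q : P' → P` with `q × T` affine, if
  the sliced family `((q × T)^* ⊗ id)(y_ab)` is a coboundary in the model of the sliced cover,
  then the pullback of the class of `y` along `q × Spec R : P' × Spec R → P × Spec R` vanishes in
  `Ȟ¹` (the shape of the hypotheses of the Künneth injectivity `Motives/KunnethH1Fibre`).

Everything is proved (sheaf-restriction bookkeeping); no new named fact.

## References

* U. Görtz, T. Wedhorn, *Algebraic Geometry II: Cohomology of Schemes*, Springer Spektrum (2023),
  doi:10.1007/978-3-658-43031-3: Lemma 24.72, proof, Step (I), p. 548; (24.14.1), p. 548 (read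
  via the held copy). [GortzWedhorn2023]
* The Stacks Project, Tag 01ED (Čech cohomology and its functoriality). [StacksProject]
-/

universe u

open CategoryTheory CategoryTheory.Limits AlgebraicGeometry MonoidalCategory TopologicalSpace
open CartesianMonoidalCategory TensorProduct Opposite
open Literature.AlgebraicGeometry.Morphisms

noncomputable section

namespace Literature.AlgebraicGeometry.Motives

namespace TowerCover

variable {K : Type u} [Field K] {T : SchemeOver K} {B : T.left.Opens} {x : B} {X : Scheme.{u}}
  [IsIntegral X] {D : CartierDivisor X} {P : SchemeOver K} {g : (P ⊗ T).left ⟶ X}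
  (𝒲 : TowerCover x D P g) (hB : IsAffineOpen B) (R : Type u) [CommRing R] [Algebra Γ(T.left, B) R]

/-! ### The covering `(ι_R⁻¹W_a)_a` of `P ×_K Spec R` -/

/-- **The covering `a ↦ ι_R⁻¹W_a` of `P ×_K Spec R`** by the thickenings of the opens of a tower
cover. [folklore] -/
def thickFamily (a : 𝒲.κ) : (P ⊗ modelPt T hB R).left.Opens := ((𝒲.W a).thick hB R).U

/-- Unfolding of `thickFamily`. [folklore] -/
@[simp] theorem thickFamily_apply (a : 𝒲.κ) :
    𝒲.thickFamily hB R a = (P ◁ modelPtι T hB R).left ⁻¹ᵁ (g ⁻¹ᵁ 𝒲.V a) := rfl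

/-- The `ι_R⁻¹W_a` are affine. [folklore] -/
theorem isAffineOpen_thickFamily (a : 𝒲.κ) : IsAffineOpen (𝒲.thickFamily hB R a) :=
  OpenOver.isAffineOpen_thick hB R _ (𝒲.isAffineOpen a)

/-- The `ι_R⁻¹W_a` cover `P ×_K Spec R` as soon as `Spec R → T` has image `{x}`. [folklore] -/
theorem iSup_thickFamily (hR : ∀ s : Spec (.of R), baseSpec T hB R s = x.1) :
    ⨆ a, 𝒲.thickFamily hB R a = ⊤ := by
  refine top_le_iff.1 fun y _ => ?_
  obtain ⟨a, ha⟩ := 𝒲.covers ((P ◁ modelPtι T hB R).left y)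
    (snd_whiskerLeft_modelPtι_apply T x hB P hR y)
  exact Opens.mem_iSup.2 ⟨a, ha⟩

/-! ### Model families as Čech cochains -/

/-- **The Čech `1`-cochain of a model family** `y = (y_ab ∈ C_ab ⊗_Λ R)`: on
`ι_R⁻¹W_a ∩ ι_R⁻¹W_b = ι_R⁻¹(W_a ∩ W_b)` it is the model image `model(y_ab)`
(`OpenOver.modelHom`, `c ⊗ r ↦ ι_R^*(c) pr^*(r)`). [folklore] -/
def cechOfModel (y : ∀ a b : 𝒲.κ, 𝒲.C₂ a b ⊗[Γ(T.left, B)] R) :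
    CechC1 (snd P (modelPt T hB R)).left (𝒲.thickFamily hB R) :=
  fun a b => (𝒲.W₂ a b).modelHom hB R (y a b)

/-- Unfolding of `cechOfModel`. [folklore] -/
theorem cechOfModel_apply (y : ∀ a b : 𝒲.κ, 𝒲.C₂ a b ⊗[Γ(T.left, B)] R) (a b : 𝒲.κ) :
    𝒲.cechOfModel hB R y a b = (𝒲.W₂ a b).modelHom hB R (y a b) := rfl

/-- **A model family satisfying the cocycle identity gives a Čech `1`-cocycle**:
`y_ab| + y_bd| = y_ad|` in `C_abd ⊗ R` implies `d¹(cechOfModel y) = 0` (naturality of the model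
map under restriction, `OpenOver.res_modelHom`). [folklore] -/
theorem cechOfModel_mem_cechZ1 (y : ∀ a b : 𝒲.κ, 𝒲.C₂ a b ⊗[Γ(T.left, B)] R)
    (hy : ∀ a b c, ten R (𝒲.r₁₂ a b c) (y a b) + ten R (𝒲.r₂₃ a b c) (y b c) =
      ten R (𝒲.r₁₃ a b c) (y a c)) :
    𝒲.cechOfModel hB R y ∈ cechZ1 (snd P (modelPt T hB R)).left (𝒲.thickFamily hB R) := by
  rw [mem_cechZ1_iff]
  funext a b c
  have key := congrArg ((𝒲.W₃ a b c).modelHom hB R) (hy a b c)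
  rw [map_add, ← OpenOver.res_modelHom hB R (V := 𝒲.W₂ a b) (W := 𝒲.W₃ a b c) inf_le_left,
    ← OpenOver.res_modelHom hB R (V := 𝒲.W₂ b c) (W := 𝒲.W₃ a b c)
      (le_inf (inf_le_left.trans inf_le_right) inf_le_right),
    ← OpenOver.res_modelHom hB R (V := 𝒲.W₂ a c) (W := 𝒲.W₃ a b c)
      (le_inf (inf_le_left.trans inf_le_left) inf_le_right)] at key
  rw [cechD1_apply]
  change OpenOver.res (OpenOver.thick_mono hB R (V := 𝒲.W₂ b c) (W := 𝒲.W₃ a b c)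
      (le_inf (inf_le_left.trans inf_le_right) inf_le_right)) ((𝒲.W₂ b c).modelHom hB R (y b c)) -
    OpenOver.res (OpenOver.thick_mono hB R (V := 𝒲.W₂ a c) (W := 𝒲.W₃ a b c)
      (le_inf (inf_le_left.trans inf_le_left) inf_le_right)) ((𝒲.W₂ a c).modelHom hB R (y a c)) +
    OpenOver.res (OpenOver.thick_mono hB R (V := 𝒲.W₂ a b) (W := 𝒲.W₃ a b c) inf_le_left)
      ((𝒲.W₂ a b).modelHom hB R (y a b)) = (0 : ((𝒲.W₃ a b c).thick hB R).Sec)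
  rw [← key]
  ring

/-- **If the Čech class of a model cocycle vanishes, it is a coboundary in the model**: from
`cechOfModel y = d⁰b` one gets `y_ab = η_b| − η_a|` with `η_a = model⁻¹(b_a) ∈ C_a ⊗ R` (the model
maps are bijective on the affine `W_a`, `W_a ∩ W_b`). [folklore] -/
theorem exists_coboundary_of_cechH1_eq_zero [IsSeparated P.hom]
    (y : ∀ a b : 𝒲.κ, 𝒲.C₂ a b ⊗[Γ(T.left, B)] R)
    (hz : 𝒲.cechOfModel hB R y ∈ cechZ1 (snd P (modelPt T hB R)).left (𝒲.thickFamily hB R))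
    (h0 : CechH1.mk (snd P (modelPt T hB R)).left (𝒲.thickFamily hB R) ⟨_, hz⟩ = 0) :
    ∃ η : ∀ a : 𝒲.κ, 𝒲.C a ⊗[Γ(T.left, B)] R,
      ∀ a b, y a b = ten R (𝒲.rr a b) (η b) - ten R (𝒲.rl a b) (η a) := by
  rw [CechH1.mk_eq_zero_iff, mem_cechB1_iff] at h0
  obtain ⟨β, hβ⟩ := h0
  refine ⟨fun a => ((𝒲.W a).modelEquiv hB R (𝒲.isAffineOpen a)).symm (β a), fun a b => ?_⟩
  apply ((𝒲.W₂ a b).modelHom_bijective hB R (𝒲.isAffineOpen_W₂ hB a b)).1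
  have ha : (𝒲.W a).modelHom hB R (((𝒲.W a).modelEquiv hB R (𝒲.isAffineOpen a)).symm (β a)) =
      β a := ((𝒲.W a).modelEquiv hB R (𝒲.isAffineOpen a)).apply_symm_apply (β a)
  have hb : (𝒲.W b).modelHom hB R (((𝒲.W b).modelEquiv hB R (𝒲.isAffineOpen b)).symm (β b)) =
      β b := ((𝒲.W b).modelEquiv hB R (𝒲.isAffineOpen b)).apply_symm_apply (β b)
  have hab := congrFun (congrFun hβ a) b
  rw [cechD0_apply] at hab
  rw [map_sub, ← OpenOver.res_modelHom hB R (V := 𝒲.W b) (W := 𝒲.W₂ a b) inf_le_right,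
    ← OpenOver.res_modelHom hB R (V := 𝒲.W a) (W := 𝒲.W₂ a b) inf_le_left, ha, hb]
  exact hab.symm

/-! ### Slices -/

/-- Restricting a pulled-back section: `(f^* s)|_W = f^*s` on `W ⊆ V` (Mathlib
`Scheme.Hom.appLE_map`, applied to an element). [folklore] -/
theorem presheaf_map_appLE {Y Z : Scheme.{u}} (f : Z ⟶ Y) {U : Y.Opens} {V W : Z.Opens}
    (e : V ≤ f ⁻¹ᵁ U) (h : W ≤ V) (s : Γ(Y, U)) :
    Z.presheaf.map (homOfLE h).op (f.appLE U V e s) = f.appLE U W (h.trans e) s := by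
  rw [← CommRingCat.comp_apply, Scheme.Hom.appLE_map]

section Slice

variable {P' : SchemeOver K} (q : P' ⟶ P)

/-- `ι'_R⁻¹((q × T)⁻¹W) = (q × Spec R)⁻¹(ι_R⁻¹W)` for an open `W` of `P × T` over `B` (both are
the preimage under `q × (Spec R → T)`). [folklore] -/
theorem thick_slicePreimage_U_eq (V : OpenOver (snd P T).left B) :
    ((V.slicePreimage q).thick hB R).U = (q ▷ modelPt T hB R).left ⁻¹ᵁ (V.thick hB R).U := by
  change (P' ◁ modelPtι T hB R).left ⁻¹ᵁ ((q ▷ T).left ⁻¹ᵁ V.U) =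
    (q ▷ modelPt T hB R).left ⁻¹ᵁ ((P ◁ modelPtι T hB R).left ⁻¹ᵁ V.U)
  rw [← Scheme.Hom.comp_preimage, ← Scheme.Hom.comp_preimage,
    OpenOver.whiskerRight_whiskerLeft_left]

variable [IsAffineHom (q ▷ T).left]

/-- The thickened opens of the sliced cover are the preimages of the `ι_R⁻¹W_a` under
`q × Spec R`. [folklore] -/
theorem slice_thickFamily (a : 𝒲.κ) :
    (𝒲.slice q).thickFamily hB R a = (q ▷ modelPt T hB R).left ⁻¹ᵁ 𝒲.thickFamily hB R a :=
  thick_slicePreimage_U_eq hB R q (𝒲.W a)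

/-- **Slices: a model coboundary on the sliced cover kills the pulled-back Čech class.** For
`q : P' → P` with `q × T` affine and a model cocycle `y` on the tower cover `𝒲` of `P`: if the
sliced family `((q × T)^* ⊗ id)(y_ab)` is a coboundary `η'_b| − η'_a|` in the model of the sliced
cover `𝒲.slice q`, then the pullback of the class of `cechOfModel y` along
`q × Spec R : P' × Spec R → P × Spec R` is zero in `Ȟ¹` (the coboundary `model(η')` on the opens
`ι'_R⁻¹((q × T)⁻¹W_a) = (q × Spec R)⁻¹(ι_R⁻¹W_a)`; `OpenOver.sliceMap_modelHom`). [folklore] -/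
theorem cechComapH1_slice_eq_zero (y : ∀ a b : 𝒲.κ, 𝒲.C₂ a b ⊗[Γ(T.left, B)] R)
    (hz : 𝒲.cechOfModel hB R y ∈ cechZ1 (snd P (modelPt T hB R)).left (𝒲.thickFamily hB R))
    (η' : ∀ a : 𝒲.κ, (𝒲.slice q).C a ⊗[Γ(T.left, B)] R)
    (hη' : ∀ a b, Algebra.TensorProduct.map (𝒲.sliceComap₂ q a b) (AlgHom.id _ R) (y a b) =
      ten R ((𝒲.slice q).rr a b) (η' b) - ten R ((𝒲.slice q).rl a b) (η' a)) :
    cechComapH1 (snd P (modelPt T hB R)).left (snd P' (modelPt T hB R)).left (q ▷ modelPt T hB R).left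
        (OpenOver.whiskerRight_snd_left q (modelPt T hB R)) (𝒲.thickFamily hB R)
      (CechH1.mk (snd P (modelPt T hB R)).left (𝒲.thickFamily hB R) ⟨_, hz⟩) = 0 := by
  rw [cechComapH1_mk_eq_zero_iff, mem_cechB1_iff]
  -- the opens `O_a = (q × Spec R)⁻¹(ι_R⁻¹W_a)` and `O'_a = ι'_R⁻¹((q × T)⁻¹W_a)` coincide
  have hO : ∀ a, (q ▷ modelPt T hB R).left ⁻¹ᵁ 𝒲.thickFamily hB R a =
      (𝒲.slice q).thickFamily hB R a :=
    fun a => (𝒲.slice_thickFamily hB R q a).symm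
  -- the `0`-cochain `model(η'_a)` moved to the opens `O_a`
  refine ⟨fun a => (P' ⊗ modelPt T hB R).left.presheaf.map (homOfLE (hO a).le).op
    (((𝒲.slice q).W a).modelHom hB R (η' a)), ?_⟩
  funext a b
  -- compare on `O_a ∩ O_b ⊆ O'_ab = ι'_R⁻¹((q × T)⁻¹(W_a ∩ W_b))`
  have hle : (q ▷ modelPt T hB R).left ⁻¹ᵁ 𝒲.thickFamily hB R a ⊓
      (q ▷ modelPt T hB R).left ⁻¹ᵁ 𝒲.thickFamily hB R b ≤
      (((𝒲.slice q).W₂ a b).thick hB R).U :=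
    fun z hz' => ⟨(hO a).le hz'.1, (hO b).le hz'.2⟩
  -- naturality of the model map under the slice, in the opens of the sliced cover
  have hsm : (𝒲.W₂ a b).sliceMap hB R q ((𝒲.W₂ a b).modelHom hB R (y a b)) =
      ((𝒲.slice q).W₂ a b).modelHom hB R
        (Algebra.TensorProduct.map (𝒲.sliceComap₂ q a b) (AlgHom.id _ R) (y a b)) :=
    OpenOver.sliceMap_modelHom hB R q (𝒲.W₂ a b) (y a b)
  rw [hη' a b, map_sub,
    ← OpenOver.res_modelHom hB R (V := (𝒲.slice q).W b) (W := (𝒲.slice q).W₂ a b) inf_le_right,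
    ← OpenOver.res_modelHom hB R (V := (𝒲.slice q).W a) (W := (𝒲.slice q).W₂ a b) inf_le_left,
    OpenOver.res_apply, OpenOver.res_apply, OpenOver.sliceMap_apply] at hsm
  have key := (congrArg ((P' ⊗ modelPt T hB R).left.presheaf.map (homOfLE hle).op) hsm).trans
    (map_sub ((P' ⊗ modelPt T hB R).left.presheaf.map (homOfLE hle).op).hom _ _)
  rw [RatFn.res_res, RatFn.res_res] at key
  erw [presheaf_map_appLE] at key
  rw [cechD0_apply, cechComapC1_apply, Sections.comap_apply, Sections.res_apply,
    Sections.res_apply, RatFn.res_res, RatFn.res_res]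
  exact key.symm

end Slice

end TowerCover

end Literature.AlgebraicGeometry.Motives

end
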